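import Summits.QuantumAdvantage.Dequantization.GraphStateRotationInputs
import Summits.QuantumAdvantage.Dequantization.GraphStateRotationMarginals
import HarnessLib

/-!
# Graph-state rotation learning — reduction to the active subgraph (Lemma E25-1, part 2)

HONEST FRAMING: instance-level adjudication of specific advantage claims; no claim about
BQP vs BPP or the summit.

Source modelled: arXiv:2509.09033v1, Definition 16 / Algorithm 1, general input `x`
(definitions in `GraphStateRotationInputs`).  Results (cell note DEQ-E25 §2, Lemma E25-1):

* `activeGraph G x` — the ACTIVE SUBGRAPH `G_x`: the edges of `G` joining two active wires;
* `correlatorX_eq_correlator_activeGraph` — for `S ⊆ A_x`, `E_G[χ_S | x] = E_{G_x}[χ_S]`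
  (the all-`|+⟩` model of the base module on `G_x`);
* `probX_congr_inactive` — `p(y|x)` depends on `y` only through `y|_{A_x}`: the inactive
  output bits are independent fair coins;
* `probX_eq_sum_correlator_activeGraph`, `probX_eq_margProb_activeGraph` —
  `p(y|x) = 2^{-n} Σ_{S ⊆ A_x} E_{G_x}[χ_S] χ_S(y) = p^{G_x}_{A_x}(y|_{A_x}) · 2^{|A_x| - n}`:
  the output law given `x` is the `A_x`-marginal of the base model on `G_x` (module
  `GraphStateRotationMarginals`), times independent fair coins on the inactive wires.

Everything is proved from the definitions (no axioms beyond Mathlib's, no `sorry`).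
-/

noncomputable section

namespace Summit.QuantumAdvantage.Dequantization.GraphStateRotationCorrelators

open Finset Matrix
open scoped ComplexConjugate
open Literature.Probability.RandomGraphs.LowDegree (sgn walsh sum_walsh_mul_walsh)
open Literature.Computability.Cryptography (QReg)
open Literature.Barriers.QuantumAdvantage (supp bxor indic)

variable {n : ℕ} (G : SimpleGraph (Fin n)) [DecidableRel G.Adj] (θ : Fin n → ℝ)

omit [DecidableRel G.Adj] in
/-- The ACTIVE SUBGRAPH `G_x` on the same wire set: the edges of `G` joining two active wires
(an inactive wire becomes isolated). -/
def activeGraph (x : QReg n) : SimpleGraph (Fin n) where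
  Adj a b := G.Adj a b ∧ x a = false ∧ x b = false
  symm := ⟨fun _ _ h => ⟨h.1.symm, h.2.2, h.2.1⟩⟩
  loopless := ⟨fun _ h => G.irrefl h.1⟩

/-- Adjacency in `G_x` is decidable. -/
instance activeGraph.instDecidableRelAdj (x : QReg n) : DecidableRel (activeGraph G x).Adj :=
  fun a b => inferInstanceAs (Decidable (G.Adj a b ∧ x a = false ∧ x b = false))

omit [DecidableRel G.Adj] in
/-- Adjacency in `G_x`, unfolded. -/
theorem activeGraph_adj {x : QReg n} {a b : Fin n} :
    (activeGraph G x).Adj a b ↔ G.Adj a b ∧ x a = false ∧ x b = false := Iff.rfl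

/-- On an active wire and `S ⊆ A_x`, `G` and `G_x` see the same neighbours in `S`. -/
theorem nbrIn_activeGraph_of_active {x : QReg n} {S : Finset (Fin n)}
    (hS : ∀ b ∈ S, x b = false) {a : Fin n} (hxa : x a = false) :
    nbrIn (activeGraph G x) S a = nbrIn G S a :=
  congrArg Finset.card (Finset.filter_congr fun b _ =>
    ⟨fun h => ⟨((activeGraph_adj G).mp h.1).1, h.2⟩,
     fun h => ⟨(activeGraph_adj G).mpr ⟨h.1, hxa, hS b h.2⟩, h.2⟩⟩)

/-- An inactive wire is isolated in `G_x`. -/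
theorem nbrIn_activeGraph_of_inactive {x : QReg n} (S : Finset (Fin n)) {a : Fin n}
    (hxa : x a = true) : nbrIn (activeGraph G x) S a = 0 := by
  rw [nbrIn, Finset.card_eq_zero, Finset.filter_eq_empty_iff]
  rintro b - ⟨hadj, -⟩
  have h := ((activeGraph_adj G).mp hadj).2.1
  rw [h] at hxa; exact Bool.false_ne_true hxa

/-- For `S ⊆ A_x`, `G` and `G_x` have the same edges inside `S`. -/
theorem edgesIn_activeGraph {x : QReg n} {S : Finset (Fin n)} (hS : ∀ b ∈ S, x b = false) :
    edgesIn (activeGraph G x) S = edgesIn G S :=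
  congrArg Finset.card (Finset.filter_congr fun _ _ =>
    ⟨fun h => ⟨h.1, ((activeGraph_adj G).mp h.2.1).1, h.2.2.1, h.2.2.2⟩,
     fun h => ⟨h.1, (activeGraph_adj G).mpr ⟨h.2.1, hS _ h.2.2.1, hS _ h.2.2.2⟩, h.2.2.1,
       h.2.2.2⟩⟩)

/-- Wire factors agree on active wires (`S ⊆ A_x`). -/
theorem wire_activeGraph_of_active {x : QReg n} {S : Finset (Fin n)}
    (hS : ∀ b ∈ S, x b = false) {a : Fin n} (hxa : x a = false) :
    wire (activeGraph G x) θ S a = wire G θ S a := by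
  unfold wire; rw [nbrIn_activeGraph_of_active G hS hxa]

/-- The `G_x`-wire factor of an inactive wire is `1` (`S ⊆ A_x`). -/
theorem wire_activeGraph_of_inactive {x : QReg n} {S : Finset (Fin n)}
    (hS : ∀ b ∈ S, x b = false) {a : Fin n} (hxa : x a = true) :
    wire (activeGraph G x) θ S a = 1 := by
  have haS : a ∉ S := fun h => by rw [hS a h] at hxa; exact Bool.false_ne_true hxa
  rw [wire, if_neg haS, nbrIn_activeGraph_of_inactive G S hxa, if_pos Even.zero]

/-- **Lemma E25-1 (correlator form).** For `S ⊆ A_x` the conditional correlator of Algorithm 1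
on input `x` equals the correlator of the all-`|+⟩` model on the active subgraph `G_x`:
`E_G[χ_S | x] = E_{G_x}[χ_S]` (and it is `0` for every other `S`,
`correlatorX_eq_zero_of_inactive`). -/
theorem correlatorX_eq_correlator_activeGraph {x : QReg n} {S : Finset (Fin n)}
    (hS : ∀ a ∈ S, x a = false) :
    correlatorX G θ x S = correlator (activeGraph G x) θ S := by
  have h1 := correlatorX_eq_prod_of_active G θ hS
  have h2 := correlator_eq_prod (activeGraph G x) θ S
  rw [edgesIn_activeGraph G hS,
    ← Finset.prod_filter_mul_prod_filter_not univ (fun a => x a = false),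
    Finset.prod_congr (show univ.filter (fun a => x a = false) = active x from rfl)
      (fun a ha => wire_activeGraph_of_active G θ hS (mem_active.mp ha)),
    Finset.prod_eq_one (fun a ha => wire_activeGraph_of_inactive G θ hS
      (by simpa using (Finset.mem_filter.mp ha).2)), mul_one, ← h1] at h2
  exact_mod_cast h2.symm

/-- **Walsh inversion on the cube**: `Σ_S (Σ_{y'} p(y') χ_S(y')) χ_S(y) = 2^n p(y)`. -/
theorem walsh_inversion (p : QReg n → ℝ) (y : QReg n) :
    ∑ S, (∑ y', p y' * walsh S y') * walsh S y = 2 ^ n * p y := by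
  calc ∑ S, (∑ y', p y' * walsh S y') * walsh S y
      = ∑ y', p y' * ∑ S, walsh S y' * walsh S y := by
        simp_rw [Finset.sum_mul, Finset.mul_sum]
        rw [Finset.sum_comm]
        exact Finset.sum_congr rfl fun y' _ => Finset.sum_congr rfl fun S _ => by ring
    _ = 2 ^ n * p y := by
        simp_rw [sum_walsh_mul_walsh, Fintype.card_fin, mul_ite, mul_zero, Finset.sum_ite_eq',
          Finset.mem_univ, if_true]
        ring

/-- `p(y|x)` through its correlators: `p(y|x) = 2^{-n} Σ_S E[χ_S | x] χ_S(y)`. -/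
theorem probX_eq_sum_correlatorX (x y : QReg n) :
    probX G θ x y = (∑ S, correlatorX G θ x S * walsh S y) / 2 ^ n := by
  have h2 : (2 : ℝ) ^ n ≠ 0 := by positivity
  rw [eq_div_iff h2]
  have h := walsh_inversion (probX G θ x) y
  unfold correlatorX
  rw [h]; ring

/-- **Lemma E25-1 (i): the inactive output bits are independent fair coins** — `p(y|x)` depends
on `y` only through its restriction to the active wires. -/
theorem probX_congr_inactive {x y y' : QReg n} (h : ∀ a ∈ active x, y a = y' a) :
    probX G θ x y = probX G θ x y' := by
  have h2 : (2 : ℝ) ^ n ≠ 0 := by positivity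
  rw [probX_eq_sum_correlatorX, probX_eq_sum_correlatorX, div_left_inj' h2]
  refine Finset.sum_congr rfl fun S _ => ?_
  by_cases hS : ∀ a ∈ S, x a = false
  · rw [show walsh S y = walsh S y' from
      Finset.prod_congr rfl fun a ha => by rw [h a (mem_active.mpr (hS a ha))]]
  · push Not at hS
    obtain ⟨a, ha, hxa⟩ := hS
    rw [correlatorX_eq_zero_of_inactive G θ ha (by simpa using hxa), zero_mul, zero_mul]

/-- **Lemma E25-1 (ii): reduction to the active subgraph.**
`p(y|x) = 2^{-n} Σ_{S ⊆ A_x} E_{G_x}[χ_S] χ_S(y)`: the output law given `x` is the law of the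
all-`|+⟩` model on `G_x` on the active wires, times independent fair coins on the inactive
wires.  (With `margProb_eq_sum_correlator` of the marginals module this reads
`p(y|x) = p^{G_x}_{A_x}(y|_{A_x}) / 2^{n-|A_x|}`.) -/
theorem probX_eq_sum_correlator_activeGraph (x y : QReg n) :
    probX G θ x y =
      (∑ S ∈ (active x).powerset, correlator (activeGraph G x) θ S * walsh S y) / 2 ^ n := by
  have h2 : (2 : ℝ) ^ n ≠ 0 := by positivity
  rw [probX_eq_sum_correlatorX, div_left_inj' h2,
    ← Finset.sum_subset (Finset.subset_univ (active x).powerset)]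
  · refine Finset.sum_congr rfl fun S hS => ?_
    rw [correlatorX_eq_correlator_activeGraph G θ
      (fun a ha => mem_active.mp (Finset.mem_powerset.mp hS ha))]
  · intro S _ hS
    rw [Finset.mem_powerset, Finset.not_subset] at hS
    obtain ⟨a, ha, hna⟩ := hS
    rw [correlatorX_eq_zero_of_inactive G θ ha (by simpa [mem_active] using hna), zero_mul]

/-- **Lemma E25-1 (marginal form).** `p(y|x) = p^{G_x}_{A_x}(y|_{A_x}) · 2^{|A_x|} / 2^n`: the
output law given `x` is the `A_x`-marginal law of the all-`|+⟩` model on `G_x`, times the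
uniform law on the `n - |A_x|` inactive output bits. -/
theorem probX_eq_margProb_activeGraph (x y : QReg n) :
    probX G θ x y =
      margProb (activeGraph G x) θ (active x) y * 2 ^ (active x).card / 2 ^ n := by
  rw [probX_eq_sum_correlator_activeGraph, margProb_eq_sum_correlator,
    div_mul_cancel₀ _ (by positivity : (2 : ℝ) ^ (active x).card ≠ 0)]

end Summit.QuantumAdvantage.Dequantization.GraphStateRotationCorrelators

end
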